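import Literature.NumberTheory.Sieve.LinearEquationsInPrimesSieveWeights
import Literature.NumberTheory.Sieve.LinearEquationsInPrimesSieveTau
import Mathlib.NumberTheory.Harmonic.Bounds
import Mathlib.Data.Finset.NatDivisors
import HarnessLib

/-!
# Crude divisor moments along a `W`-progression (for the enveloping sieve, Green–Tao 2010, App. D)

Trunk T-SIEVE (`Literature/NumberTheory/Sieve`). Elementary input for the App. D layer of the
decomposition of `Literature.NumberTheory.Sieve.GreenTaoZiegler2012_finiteComplexity` (the
verification of the correlation condition for Green–Tao's enveloping-sieve measure, B. Green,
T. Tao, *Linear equations in primes*, Ann. of Math. 171 (2010), App. D, proof of Prop. 6.4: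
"We may assume that no two of the `h_i` are equal as in this case one can use crude divisor
estimates, setting `τ(0)` to be moderately large (see [Green–Tao 2008] for details)").

The "crude divisor estimates" needed there are polylogarithmic moment bounds for the truncated
divisor sums `Λ_{χ,R,2}(Wn + b)` over `n ∈ [N]`. This file proves them from first principles:

* `Literature.NumberTheory.Sieve.sum_Icc_inv_le_log` — `∑_{e ≤ R} 1/e ≤ 1 + log R` (Mathlib's
  harmonic bound);
* `Literature.NumberTheory.Sieve.card_divisors_lcm_le` — `d(lcm(a,b)) ≤ d(a) d(b)` (from the
  two-line `d(ab) ≤ d(a) d(b)`, a private copy of the tree's `Vaughan.card_divisors_mul_le` /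
  `sigma_zero_mul_le`, whose files are not imported to keep this layer's closure small);
* `Literature.NumberTheory.Sieve.divPowSum j R = ∑_{e ≤ R} d(e)^j / e ≤ (1 + log R)^{2^j}`
  (`divPowSum_le`, by `V_{j+1} ≤ V_j²`);
* the iterated lcm sums `Literature.NumberTheory.Sieve.lcmMomentSum R k j M =
  ∑_{e₁,…,e_k ≤ R} d(lcm(M,e₁,…,e_k))^j / lcm(M,e₁,…,e_k)` and the bound
  `lcmMomentSum R k j M ≤ d(M)^{c} / M · (1 + log R)^{f}` with explicit recursively defined
  exponents (`lcmMomentSum_le`); in particular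
  `∑_{e₁,…,e_k ≤ R} 1/lcm(e₁,…,e_k) ≤ (1 + log R)^{f_k}`;
* `Literature.NumberTheory.Sieve.sum_truncCount_pow_le` — for `b` coprime to `W`,
  `∑_{n ∈ [N]} d_R(Wn + b)^k ≤ N (1 + log R)^{f_k} + R^k`, where
  `d_R(y) = #{e ≤ R : e ∣ y}` (`Literature.NumberTheory.Sieve.truncCount`), using the tree's
  `card_filter_dvd_affine_le` ("`∑_{n ∈ [N], d | Wn+h} 1 = O(1 + N/d)` by the Chinese remainder
  theorem");
* `Literature.NumberTheory.Sieve.sum_truncDivisorSum_two_pow_le` — for `|χ| ≤ B`,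
  `∑_{n ∈ [N]} Λ_{χ,R,2}(Wn + b)^m ≤ (log R)^m B^{2m} (N (1 + log R)^{f_{2m}} + R^{2m})`.

Nothing here is specific to Green–Tao; the bounds are the standard "divisor function has
polylogarithmic moments" estimates in the weak form that avoids Mertens' theorems (the
exponents `f_k` are doubly exponential in `k`, which is irrelevant for the application: any
`N^{o(1)}` bound makes `τ(0)^q / N'` bounded). The tree's `DivisorPowerSums.lean`
(`Literature.NumberTheory.Sieve.exists_sum_sigma_zero_pow_div_le`: `∑_{n ≤ X} τ(n)^r/n ≪_r (log X)^{2^{r+1}}`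
by Rankin/Euler products) is sharper for the one-variable sums `V_j` but carries the import closure
of the Bombieri–Friedlander–Iwaniec files (Mertens-type inputs, Shiu's theorem); the lcm sums and
the progression moments below are not there, and we keep this App. D layer's closure light with the
two-line bound `V_{j+1} ≤ V_j²`.

## References

* B. Green, T. Tao, *Linear equations in primes*, Ann. of Math. (2) 171 (2010), App. D (proof of
  Prop. 6.4, the coincident case of the correlation condition; "`∑_{n ∈ [N], d | Wn+h} 1 = O(1 + N/d)`").
* B. Green, T. Tao, *The primes contain arbitrarily long arithmetic progressions*, Ann. of
  Math. (2) 167 (2008), proof of Prop. 9.6 / Lemma 9.10 (the crude bound in the coincident case).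
-/

noncomputable section

open Finset

namespace Literature.NumberTheory.Sieve

/-! ### Harmonic sums and the divisor function -/

/-- `∑_{e=1}^{R} 1/e ≤ 1 + log R` (Mathlib's `harmonic_le_one_add_log`). [folklore] -/
theorem sum_Icc_inv_le_log (R : ℕ) : ∑ e ∈ Icc 1 R, (1 : ℝ) / e ≤ 1 + Real.log R := by
  have h := harmonic_le_one_add_log R
  rw [harmonic_eq_sum_Icc] at h
  push_cast at h
  simpa [one_div] using h

/-- `0 ≤ 1 + log R`. [folklore] -/
theorem one_add_log_nonneg (R : ℕ) : (0 : ℝ) ≤ 1 + Real.log R := by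
  rcases Nat.eq_zero_or_pos R with rfl | hR
  · simp
  · have : (0 : ℝ) ≤ Real.log R := Real.log_nonneg (by exact_mod_cast hR)
    linarith

/-- Submultiplicativity of the divisor function: `d(ab) ≤ d(a) d(b)` (private copy of the tree's
`Vaughan.card_divisors_mul_le`, see the module docstring). [folklore] -/
private theorem card_divisors_mul_le' (a b : ℕ) : #(a * b).divisors ≤ #a.divisors * #b.divisors := by
  classical
  rw [Nat.divisors_mul]
  exact Finset.card_mul_le

/-- `#{(a,f) : af = n} = d(n)`. [folklore] -/
theorem card_divisorsAntidiagonal (n : ℕ) : #n.divisorsAntidiagonal = #n.divisors := by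
  rw [← Nat.map_div_right_divisors, Finset.card_map]

/-- `d(lcm(a,b)) ≤ d(a) d(b)` (`lcm(a,b) ∣ ab`). [folklore] -/
theorem card_divisors_lcm_le (a b : ℕ) : #(Nat.lcm a b).divisors ≤ #a.divisors * #b.divisors := by
  rcases Nat.eq_zero_or_pos a with rfl | ha
  · simp
  rcases Nat.eq_zero_or_pos b with rfl | hb
  · simp
  refine le_trans (Finset.card_le_card (Nat.divisors_subset_of_dvd (Nat.mul_ne_zero ha.ne' hb.ne')
    (Nat.lcm_dvd_mul a b))) (card_divisors_mul_le' a b)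

/-- `d(g) ≤ d(M)` for `g ∣ M ≠ 0`. [folklore] -/
theorem card_divisors_le_of_dvd {g M : ℕ} (hM : M ≠ 0) (hg : g ∣ M) :
    #g.divisors ≤ #M.divisors :=
  Finset.card_le_card (Nat.divisors_subset_of_dvd hM hg)

/-! ### `V_j(R) = ∑_{e ≤ R} d(e)^j / e` -/

/-- The weighted divisor power sums `V_j(R) = ∑_{e=1}^{R} d(e)^j / e`. [folklore] -/
def divPowSum (j R : ℕ) : ℝ :=
  ∑ e ∈ Icc 1 R, (#e.divisors : ℝ) ^ j / e

/-- `V_j(R) ≥ 0`. [folklore] -/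
theorem divPowSum_nonneg (j R : ℕ) : 0 ≤ divPowSum j R :=
  Finset.sum_nonneg fun e _ => by positivity

/-- `V_0(R) = ∑_{e ≤ R} 1/e ≤ 1 + log R`. [folklore] -/
theorem divPowSum_zero_le (R : ℕ) : divPowSum 0 R ≤ 1 + Real.log R := by
  unfold divPowSum
  simpa using sum_Icc_inv_le_log R

/-- The multiplication map `(a, f) ↦ a f` from divisor pairs: reindexing `∑_{e ≤ R} ∑_{a f = e}`
as a sum over pairs, `V_{j+1}(R) ≤ V_j(R)²` (`d(e) = #{(a,f) : af = e}` and
`d(af)^j/(af) ≤ (d(a)^j/a)(d(f)^j/f)`). [folklore] -/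
theorem divPowSum_succ_le (j R : ℕ) : divPowSum (j + 1) R ≤ divPowSum j R ^ 2 := by
  classical
  unfold divPowSum
  -- Step 1: `d(e)^{j+1}/e = ∑_{(a,f) ∈ antidiag e} d(af)^j/(af)`
  have h1 : ∀ e ∈ Icc 1 R, (#e.divisors : ℝ) ^ (j + 1) / e =
      ∑ p ∈ Nat.divisorsAntidiagonal e, (#(p.1 * p.2).divisors : ℝ) ^ j / (p.1 * p.2 : ℕ) := by
    intro e _
    have hconst : ∀ p ∈ Nat.divisorsAntidiagonal e,
        (#(p.1 * p.2).divisors : ℝ) ^ j / (p.1 * p.2 : ℕ) = (#e.divisors : ℝ) ^ j / e := by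
      intro p hp
      rw [(Nat.mem_divisorsAntidiagonal.mp hp).1]
    rw [Finset.sum_congr rfl hconst, Finset.sum_const, card_divisorsAntidiagonal,
      nsmul_eq_mul, pow_succ]
    ring
  rw [Finset.sum_congr rfl h1]
  -- Step 2: termwise bound and passage to the product set
  have h2 : ∀ e ∈ Icc 1 R, ∑ p ∈ Nat.divisorsAntidiagonal e,
      (#(p.1 * p.2).divisors : ℝ) ^ j / (p.1 * p.2 : ℕ) ≤
      ∑ p ∈ Nat.divisorsAntidiagonal e,
        (#p.1.divisors : ℝ) ^ j / p.1 * ((#p.2.divisors : ℝ) ^ j / p.2) := by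
    intro e _
    refine Finset.sum_le_sum fun p hp => ?_
    have hp12 : p.1 * p.2 = e := (Nat.mem_divisorsAntidiagonal.mp hp).1
    have he0 : e ≠ 0 := (Nat.mem_divisorsAntidiagonal.mp hp).2
    have hp1 : 0 < p.1 := Nat.pos_of_ne_zero fun h => he0 (by rw [← hp12, h, zero_mul])
    have hp2 : 0 < p.2 := Nat.pos_of_ne_zero fun h => he0 (by rw [← hp12, h, mul_zero])
    have hd : (#(p.1 * p.2).divisors : ℝ) ^ j ≤ (#p.1.divisors : ℝ) ^ j * (#p.2.divisors : ℝ) ^ j := by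
      rw [← mul_pow]
      exact pow_le_pow_left₀ (by positivity) (by exact_mod_cast card_divisors_mul_le' p.1 p.2) j
    rw [div_mul_div_comm]
    push_cast
    exact div_le_div_of_nonneg_right hd (by positivity)
  refine (Finset.sum_le_sum h2).trans ?_
  -- the antidiagonals of distinct `e` are disjoint, and all lie in `[1,R]²`
  rw [← Finset.sum_biUnion]
  · rw [sq, Finset.sum_mul_sum, ← Finset.sum_product']
    refine Finset.sum_le_sum_of_subset_of_nonneg ?_ fun p _ _ => by positivity
    intro p hp
    obtain ⟨e, he, hpe⟩ := Finset.mem_biUnion.mp hp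
    have hp12 : p.1 * p.2 = e := (Nat.mem_divisorsAntidiagonal.mp hpe).1
    have he0 : e ≠ 0 := (Nat.mem_divisorsAntidiagonal.mp hpe).2
    have heR : e ≤ R := (Finset.mem_Icc.mp he).2
    have hp1 : 0 < p.1 := Nat.pos_of_ne_zero fun h => he0 (by rw [← hp12, h, zero_mul])
    have hp2 : 0 < p.2 := Nat.pos_of_ne_zero fun h => he0 (by rw [← hp12, h, mul_zero])
    refine Finset.mem_product.mpr ⟨Finset.mem_Icc.mpr ⟨hp1, ?_⟩, Finset.mem_Icc.mpr ⟨hp2, ?_⟩⟩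
    · calc p.1 ≤ p.1 * p.2 := Nat.le_mul_of_pos_right _ hp2
        _ ≤ R := hp12 ▸ heR
    · calc p.2 ≤ p.1 * p.2 := Nat.le_mul_of_pos_left _ hp1
        _ ≤ R := hp12 ▸ heR
  · intro e _ e' _ hne
    rw [Function.onFun, Finset.disjoint_left]
    intro p hp hp'
    exact hne ((Nat.mem_divisorsAntidiagonal.mp hp).1.symm.trans (Nat.mem_divisorsAntidiagonal.mp hp').1)

/-- `V_j(R) ≤ (1 + log R)^{2^j}`. [folklore] -/
theorem divPowSum_le (j R : ℕ) : divPowSum j R ≤ (1 + Real.log R) ^ (2 ^ j) := by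
  induction j with
  | zero => simpa using divPowSum_zero_le R
  | succ j ih =>
    calc divPowSum (j + 1) R ≤ divPowSum j R ^ 2 := divPowSum_succ_le j R
      _ ≤ ((1 + Real.log R) ^ (2 ^ j)) ^ 2 := pow_le_pow_left₀ (divPowSum_nonneg j R) ih 2
      _ = (1 + Real.log R) ^ (2 ^ (j + 1)) := by rw [← pow_mul, pow_succ]

/-! ### One step: summing over one more variable of the lcm -/

/-- The multiples of `g ≥ 1` in `[1, R]` are `g · [1, R/g]` (a local copy of the tree's
`filter_dvd_Icc_eq_image` of `AsymptoticSieveForPrimesLogSums.lean`, not imported to keep this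
layer's closure small). [folklore] -/
private theorem multiples_Icc_eq_image {g : ℕ} (hg : 1 ≤ g) (R : ℕ) :
    (Icc 1 R).filter (fun e => g ∣ e) = (Icc 1 (R / g)).image (fun f => g * f) := by
  ext e
  simp only [mem_filter, mem_Icc, mem_image]
  constructor
  · rintro ⟨⟨h1, h2⟩, ⟨f, rfl⟩⟩
    refine ⟨f, ⟨?_, ?_⟩, rfl⟩
    · rcases Nat.eq_zero_or_pos f with rfl | hf
      · simp at h1
      · exact hf
    · exact (Nat.le_div_iff_mul_le hg).mpr (by rw [mul_comm]; exact h2)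
  · rintro ⟨f, ⟨h1, h2⟩, rfl⟩
    refine ⟨⟨Nat.le_mul_of_pos_right _ h1 |>.trans' hg, ?_⟩, dvd_mul_right g f⟩
    have := (Nat.le_div_iff_mul_le hg).mp h2
    rw [mul_comm]; exact this

/-- `∑_{e ≤ R, g | e} d(e)^c / e ≤ (d(g)^c / g) V_c(R)` for `g ≥ 1`. [folklore] -/
theorem sum_filter_dvd_divPow_le {g : ℕ} (hg : 1 ≤ g) (c R : ℕ) :
    ∑ e ∈ (Icc 1 R).filter (fun e => g ∣ e), (#e.divisors : ℝ) ^ c / e ≤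
      (#g.divisors : ℝ) ^ c / g * divPowSum c R := by
  rw [multiples_Icc_eq_image hg, Finset.sum_image fun f _ f' _ h =>
    Nat.eq_of_mul_eq_mul_left hg h]
  unfold divPowSum
  rw [Finset.mul_sum]
  have hsub : Icc 1 (R / g) ⊆ Icc 1 R := Finset.Icc_subset_Icc_right (Nat.div_le_self R g)
  refine le_trans ?_ (Finset.sum_le_sum_of_subset_of_nonneg hsub fun f _ _ => by positivity)
  refine Finset.sum_le_sum fun f hf => ?_
  have hf1 : 1 ≤ f := (Finset.mem_Icc.mp hf).1
  have hd : (#(g * f).divisors : ℝ) ^ c ≤ (#g.divisors : ℝ) ^ c * (#f.divisors : ℝ) ^ c := by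
    rw [← mul_pow]
    exact pow_le_pow_left₀ (by positivity) (by exact_mod_cast card_divisors_mul_le' g f) c
  rw [div_mul_div_comm]
  push_cast
  exact div_le_div_of_nonneg_right hd (by positivity)

/-- **One more variable**: for `M ≠ 0`,
`∑_{e ≤ R} d(lcm(M,e))^c / lcm(M,e) ≤ d(M)^{2c+1} / M · V_c(R)`
(`1/lcm = gcd/(Me)`, `d(lcm) ≤ d(M) d(e)`, `gcd(M,e) ≤ ∑_{g | M, g | e} g`, and
`sum_filter_dvd_divPow_le`). [folklore] -/
theorem sum_divPow_lcm_le {M : ℕ} (hM : M ≠ 0) (c R : ℕ) :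
    ∑ e ∈ Icc 1 R, (#(Nat.lcm M e).divisors : ℝ) ^ c / Nat.lcm M e ≤
      (#M.divisors : ℝ) ^ (2 * c + 1) / M * divPowSum c R := by
  classical
  have hM0 : (0 : ℝ) < M := by exact_mod_cast Nat.pos_of_ne_zero hM
  -- termwise: `d(lcm)^c/lcm ≤ (d(M)^c/M) · d(e)^c/e · ∑_{g | M, g | e} g`
  have hterm : ∀ e ∈ Icc 1 R, (#(Nat.lcm M e).divisors : ℝ) ^ c / Nat.lcm M e ≤
      (#M.divisors : ℝ) ^ c / M * ∑ g ∈ M.divisors.filter (fun g => g ∣ e),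
        (g : ℝ) * ((#e.divisors : ℝ) ^ c / e) := by
    intro e he
    have he1 : 1 ≤ e := (Finset.mem_Icc.mp he).1
    have he0 : (0 : ℝ) < e := by exact_mod_cast he1
    have hlcm0 : 0 < Nat.lcm M e := Nat.lcm_pos (Nat.pos_of_ne_zero hM) he1
    -- `1/lcm = gcd/(M e)`
    have hlcm : (Nat.lcm M e : ℝ) = M * e / Nat.gcd M e := by
      have h := Nat.gcd_mul_lcm M e
      have hg0 : (0 : ℝ) < Nat.gcd M e := by exact_mod_cast Nat.gcd_pos_of_pos_left e (Nat.pos_of_ne_zero hM)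
      rw [eq_div_iff hg0.ne']
      exact_mod_cast (by rw [mul_comm]; exact h : Nat.lcm M e * Nat.gcd M e = M * e)
    have hd : (#(Nat.lcm M e).divisors : ℝ) ^ c ≤ (#M.divisors : ℝ) ^ c * (#e.divisors : ℝ) ^ c := by
      rw [← mul_pow]
      exact pow_le_pow_left₀ (by positivity) (by exact_mod_cast card_divisors_lcm_le M e) c
    -- `gcd ≤ ∑_{g | M, g | e} g`
    have hgcd : (Nat.gcd M e : ℝ) ≤ ∑ g ∈ M.divisors.filter (fun g => g ∣ e), (g : ℝ) := by
      have hmem : Nat.gcd M e ∈ M.divisors.filter (fun g => g ∣ e) :=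
        Finset.mem_filter.mpr ⟨Nat.mem_divisors.mpr ⟨Nat.gcd_dvd_left M e, hM⟩, Nat.gcd_dvd_right M e⟩
      exact Finset.single_le_sum (f := fun g : ℕ => (g : ℝ)) (fun g _ => Nat.cast_nonneg g) hmem
    calc (#(Nat.lcm M e).divisors : ℝ) ^ c / Nat.lcm M e
        = (#(Nat.lcm M e).divisors : ℝ) ^ c * Nat.gcd M e / (M * e) := by
          rw [hlcm]; field_simp
      _ ≤ (#M.divisors : ℝ) ^ c * (#e.divisors : ℝ) ^ c *
            (∑ g ∈ M.divisors.filter (fun g => g ∣ e), (g : ℝ)) / (M * e) := by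
          refine div_le_div_of_nonneg_right ?_ (by positivity)
          exact mul_le_mul hd hgcd (Nat.cast_nonneg _) (by positivity)
      _ = (#M.divisors : ℝ) ^ c / M * ∑ g ∈ M.divisors.filter (fun g => g ∣ e),
            (g : ℝ) * ((#e.divisors : ℝ) ^ c / e) := by
          rw [← Finset.sum_mul]
          field_simp
  refine (Finset.sum_le_sum hterm).trans ?_
  rw [← Finset.mul_sum]
  -- swap the sums: `∑_e ∑_{g | M, g | e} = ∑_{g | M} ∑_{e, g | e}`
  have hswap : ∑ e ∈ Icc 1 R, ∑ g ∈ M.divisors.filter (fun g => g ∣ e),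
      (g : ℝ) * ((#e.divisors : ℝ) ^ c / e) =
      ∑ g ∈ M.divisors, (g : ℝ) * ∑ e ∈ (Icc 1 R).filter (fun e => g ∣ e),
        (#e.divisors : ℝ) ^ c / e := by
    rw [Finset.sum_comm' (t' := M.divisors) (s' := fun g => (Icc 1 R).filter (fun e => g ∣ e))]
    · refine Finset.sum_congr rfl fun g _ => ?_
      rw [Finset.mul_sum]
    · intro e g
      simp only [Finset.mem_filter]
      tauto
  rw [hswap]
  -- bound each inner sum
  have hinner : ∀ g ∈ M.divisors, (g : ℝ) * ∑ e ∈ (Icc 1 R).filter (fun e => g ∣ e),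
      (#e.divisors : ℝ) ^ c / e ≤ (#M.divisors : ℝ) ^ c * divPowSum c R := by
    intro g hg
    have hg1 : 1 ≤ g := Nat.pos_of_mem_divisors hg
    have hgM : g ∣ M := Nat.dvd_of_mem_divisors hg
    have hg0 : (0 : ℝ) < g := by exact_mod_cast hg1
    calc (g : ℝ) * ∑ e ∈ (Icc 1 R).filter (fun e => g ∣ e), (#e.divisors : ℝ) ^ c / e
        ≤ (g : ℝ) * ((#g.divisors : ℝ) ^ c / g * divPowSum c R) :=
          mul_le_mul_of_nonneg_left (sum_filter_dvd_divPow_le hg1 c R) hg0.le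
      _ = (#g.divisors : ℝ) ^ c * divPowSum c R := by field_simp
      _ ≤ (#M.divisors : ℝ) ^ c * divPowSum c R := by
          refine mul_le_mul_of_nonneg_right ?_ (divPowSum_nonneg c R)
          exact pow_le_pow_left₀ (by positivity) (by exact_mod_cast card_divisors_le_of_dvd hM hgM) c
  calc (#M.divisors : ℝ) ^ c / M * ∑ g ∈ M.divisors, (g : ℝ) *
        ∑ e ∈ (Icc 1 R).filter (fun e => g ∣ e), (#e.divisors : ℝ) ^ c / e
      ≤ (#M.divisors : ℝ) ^ c / M * ∑ g ∈ M.divisors, (#M.divisors : ℝ) ^ c * divPowSum c R :=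
        mul_le_mul_of_nonneg_left (Finset.sum_le_sum hinner) (by positivity)
    _ = (#M.divisors : ℝ) ^ (2 * c + 1) / M * divPowSum c R := by
        rw [Finset.sum_const, nsmul_eq_mul]
        ring

/-! ### Iterated lcm sums -/

/-- The iterated lcm sums `S_{k,j}(M) = ∑_{e₁, …, e_k ∈ [1,R]} d(lcm(M, e₁, …, e_k))^j / lcm(M, e₁, …, e_k)`,
defined by recursion on the number `k` of variables (`lcm(M, e₁, …, e_{k+1}) = lcm(lcm(M, e₁), e₂, …)`).
[folklore] -/
def lcmMomentSum (R : ℕ) : ℕ → ℕ → ℕ → ℝ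
  | 0, j, M => (#M.divisors : ℝ) ^ j / M
  | k + 1, j, M => ∑ e ∈ Icc 1 R, lcmMomentSum R k j (Nat.lcm M e)

/-- `S_{k,j}(M) ≥ 0`. [folklore] -/
theorem lcmMomentSum_nonneg (R : ℕ) : ∀ k j M : ℕ, 0 ≤ lcmMomentSum R k j M
  | 0, j, M => by unfold lcmMomentSum; positivity
  | k + 1, j, M => by
    unfold lcmMomentSum
    exact Finset.sum_nonneg fun e _ => lcmMomentSum_nonneg R k j _

/-- The divisor exponent `c(k, j)` of the bound `S_{k,j}(M) ≤ d(M)^{c(k,j)}/M · (1+log R)^{f(k,j)}`: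
`c(0,j) = j`, `c(k+1,j) = 2 c(k,j) + 1`. [folklore] -/
def lcmDivExp : ℕ → ℕ → ℕ
  | 0, j => j
  | k + 1, j => 2 * lcmDivExp k j + 1

/-- The logarithmic exponent `f(k, j)`: `f(0, j) = 0`, `f(k+1, j) = f(k,j) + 2^{c(k,j)}`. [folklore] -/
def lcmLogExp : ℕ → ℕ → ℕ
  | 0, _ => 0
  | k + 1, j => lcmLogExp k j + 2 ^ (lcmDivExp k j)

/-- **The iterated lcm-sum bound**: for `M ≠ 0`,
`S_{k,j}(M) ≤ d(M)^{c(k,j)} / M · (1 + log R)^{f(k,j)}`, by induction on `k`: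
`S_{k+1,j}(M) = ∑_e S_{k,j}(lcm(M,e)) ≤ (1+log R)^{f} ∑_e d(lcm(M,e))^{c}/lcm(M,e)
 ≤ (1+log R)^{f} d(M)^{2c+1}/M · V_c(R) ≤ d(M)^{2c+1}/M · (1+log R)^{f + 2^c}`
(`sum_divPow_lcm_le`, `divPowSum_le`). [folklore] -/
theorem lcmMomentSum_le (R : ℕ) : ∀ (k j : ℕ) {M : ℕ}, M ≠ 0 →
    lcmMomentSum R k j M ≤ (#M.divisors : ℝ) ^ (lcmDivExp k j) / M * (1 + Real.log R) ^ (lcmLogExp k j)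
  | 0, j, M, _ => by simp [lcmMomentSum, lcmDivExp, lcmLogExp]
  | k + 1, j, M, hM => by
    have hH := one_add_log_nonneg R
    show ∑ e ∈ Icc 1 R, lcmMomentSum R k j (Nat.lcm M e) ≤ _
    calc ∑ e ∈ Icc 1 R, lcmMomentSum R k j (Nat.lcm M e)
        ≤ ∑ e ∈ Icc 1 R, (#(Nat.lcm M e).divisors : ℝ) ^ (lcmDivExp k j) / Nat.lcm M e *
            (1 + Real.log R) ^ (lcmLogExp k j) := by
          refine Finset.sum_le_sum fun e he => lcmMomentSum_le R k j ?_
          exact (Nat.lcm_pos (Nat.pos_of_ne_zero hM) (Finset.mem_Icc.mp he).1).ne'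
      _ = (∑ e ∈ Icc 1 R, (#(Nat.lcm M e).divisors : ℝ) ^ (lcmDivExp k j) / Nat.lcm M e) *
            (1 + Real.log R) ^ (lcmLogExp k j) := by rw [Finset.sum_mul]
      _ ≤ (#M.divisors : ℝ) ^ (2 * lcmDivExp k j + 1) / M * divPowSum (lcmDivExp k j) R *
            (1 + Real.log R) ^ (lcmLogExp k j) :=
          mul_le_mul_of_nonneg_right (sum_divPow_lcm_le hM _ R) (by positivity)
      _ ≤ (#M.divisors : ℝ) ^ (2 * lcmDivExp k j + 1) / M *
            (1 + Real.log R) ^ (2 ^ (lcmDivExp k j)) * (1 + Real.log R) ^ (lcmLogExp k j) := by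
          refine mul_le_mul_of_nonneg_right ?_ (by positivity)
          exact mul_le_mul_of_nonneg_left (divPowSum_le _ R) (by positivity)
      _ = (#M.divisors : ℝ) ^ (lcmDivExp (k + 1) j) / M * (1 + Real.log R) ^ (lcmLogExp (k + 1) j) := by
          simp only [lcmDivExp, lcmLogExp, pow_add]
          ring

/-- In particular `∑_{e₁,…,e_k ≤ R} 1 / lcm(e₁,…,e_k) ≤ (1 + log R)^{f(k,0)}`. [folklore] -/
theorem lcmMomentSum_zero_one_le (R k : ℕ) :
    lcmMomentSum R k 0 1 ≤ (1 + Real.log R) ^ (lcmLogExp k 0) := by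
  have h := lcmMomentSum_le R k 0 one_ne_zero
  simp only [Nat.divisors_one, Finset.card_singleton, Nat.cast_one, one_pow, div_one, one_mul] at h
  exact h

/-! ### Divisor counts below `R` along a `W`-progression -/

/-- `d_R(y) = #{e ∈ [1, R] : e ∣ y}`, the number of divisors of `y` up to `R` (the range of the
truncated divisor sums `Λ_{χ,R,a}`). [cite: GreenTao2010, App. D (definition of `Λ_{χ,R,a}`)] -/
def truncCount (R : ℕ) (y : ℤ) : ℕ :=
  #((Icc 1 R).filter fun e : ℕ => (e : ℤ) ∣ y)

/-- The counting recursion `F_k(M, y) = ∑_{e₁,…,e_k ≤ R} 1_{lcm(M, e₁, …, e_k) ∣ y}` (same recursion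
as `lcmMomentSum`). [folklore] -/
def lcmCount (R : ℕ) (y : ℤ) : ℕ → ℕ → ℝ
  | 0, M => if (M : ℤ) ∣ y then 1 else 0
  | k + 1, M => ∑ e ∈ Icc 1 R, lcmCount R y k (Nat.lcm M e)

/-- `lcm(M, e) ∣ y ↔ M ∣ y ∧ e ∣ y` for an integer `y`. [folklore] -/
theorem natCast_lcm_dvd_iff (M e : ℕ) (y : ℤ) :
    ((Nat.lcm M e : ℕ) : ℤ) ∣ y ↔ (M : ℤ) ∣ y ∧ (e : ℤ) ∣ y := by
  rw [Int.natCast_dvd, Int.natCast_dvd, Int.natCast_dvd, Nat.lcm_dvd_iff]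

/-- `F_k(M, y) = 1_{M ∣ y} d_R(y)^k` (`∏ⱼ 1_{eⱼ ∣ y} 1_{M ∣ y} = 1_{lcm ∣ y}`). [folklore] -/
theorem lcmCount_eq (R : ℕ) (y : ℤ) : ∀ k M : ℕ,
    lcmCount R y k M = (if (M : ℤ) ∣ y then 1 else 0) * (truncCount R y : ℝ) ^ k
  | 0, M => by simp [lcmCount]
  | k + 1, M => by
    classical
    show ∑ e ∈ Icc 1 R, lcmCount R y k (Nat.lcm M e) = _
    simp_rw [lcmCount_eq R y k]
    by_cases hM : (M : ℤ) ∣ y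
    · rw [if_pos hM, one_mul, pow_succ]
      have h : ∀ e ∈ Icc 1 R, (if ((Nat.lcm M e : ℕ) : ℤ) ∣ y then (1 : ℝ) else 0) *
          (truncCount R y : ℝ) ^ k = (truncCount R y : ℝ) ^ k * (if (e : ℤ) ∣ y then 1 else 0) := by
        intro e _
        by_cases he : (e : ℤ) ∣ y
        · rw [if_pos ((natCast_lcm_dvd_iff M e y).mpr ⟨hM, he⟩), if_pos he, one_mul, mul_one]
        · rw [if_neg (fun h => he ((natCast_lcm_dvd_iff M e y).mp h).2), if_neg he, zero_mul,
            mul_zero]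
      rw [Finset.sum_congr rfl h, ← Finset.mul_sum, Finset.sum_boole]
      rfl
    · rw [if_neg hM, zero_mul]
      refine Finset.sum_eq_zero fun e _ => ?_
      rw [if_neg (fun h => hM ((natCast_lcm_dvd_iff M e y).mp h).1), zero_mul]

/-- **Divisibility along a `W`-progression, all moduli**: for `b` coprime to `W ≥ 1`,
`#{n ∈ [N] : M ∣ Wn + b} ≤ N/M + 1` — by `card_filter_dvd_affine_le` when `M` is coprime to `W`,
while for `M` sharing a prime with `W` (or `M = 0`) there are no such `n`.
[cite: GreenTao2010, App. D (end of the proof of Prop. 6.4)] -/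
theorem card_filter_dvd_progression_le {W b : ℕ} (hb : Nat.Coprime b W) (hW : 1 ≤ W) (M N : ℕ) :
    (#((Icc 1 N).filter fun n : ℕ => (M : ℤ) ∣ (W : ℤ) * n + b) : ℝ) ≤ N / M + 1 := by
  classical
  rcases Nat.eq_zero_or_pos M with rfl | hM
  · -- `0 ∣ Wn + b` forces `Wn + b = 0`, impossible for `n ≥ 1`
    have hempty : (Icc 1 N).filter (fun n : ℕ => ((0 : ℕ) : ℤ) ∣ (W : ℤ) * n + b) = ∅ := by
      refine Finset.filter_eq_empty_iff.mpr fun n hn h0 => ?_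
      rw [Nat.cast_zero, zero_dvd_iff] at h0
      have hn1 : 1 ≤ n := (Finset.mem_Icc.mp hn).1
      have : (1 : ℤ) ≤ (W : ℤ) * n + b := by
        have h1 : (1 : ℤ) ≤ (W : ℤ) * n := by
          have := Nat.mul_le_mul hW hn1
          exact_mod_cast this
        have h2 : (0 : ℤ) ≤ b := by positivity
        linarith
      omega
    rw [hempty]
    simp
  by_cases hcop : Nat.Coprime M W
  · have h := card_filter_dvd_affine_le hcop (b : ℤ) N
    calc (#((Icc 1 N).filter fun n : ℕ => (M : ℤ) ∣ (W : ℤ) * n + b) : ℝ) ≤ ((N / M + 1 : ℕ) : ℝ) := by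
          exact_mod_cast h
      _ ≤ N / M + 1 := by
          have hdiv : ((N / M : ℕ) : ℝ) ≤ (N : ℝ) / M := Nat.cast_div_le
          push_cast
          linarith
  · -- a common prime of `M` and `W` cannot divide `Wn + b`
    have hempty : (Icc 1 N).filter (fun n : ℕ => (M : ℤ) ∣ (W : ℤ) * n + b) = ∅ := by
      refine Finset.filter_eq_empty_iff.mpr fun n _ hdvd => hcop ?_
      rw [Nat.coprime_iff_gcd_eq_one]
      by_contra hg
      obtain ⟨p, hp, hpg⟩ := Nat.exists_prime_and_dvd hg
      have hpM : p ∣ M := hpg.trans (Nat.gcd_dvd_left M W)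
      have hpW : p ∣ W := hpg.trans (Nat.gcd_dvd_right M W)
      have h1 : (p : ℤ) ∣ (W : ℤ) * n + b := (Int.natCast_dvd_natCast.mpr hpM).trans hdvd
      have h2 : (p : ℤ) ∣ (W : ℤ) * n := (Int.natCast_dvd_natCast.mpr hpW).mul_right _
      have h3 : (p : ℤ) ∣ (b : ℤ) := (Int.dvd_add_right h2).mp h1
      have hpb : p ∣ b := Int.natCast_dvd_natCast.mp h3
      have : p ∣ Nat.gcd b W := Nat.dvd_gcd hpb hpW
      rw [Nat.coprime_iff_gcd_eq_one.mp hb] at this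
      exact hp.one_lt.ne' (Nat.dvd_one.mp this)
    rw [hempty]
    simp only [Finset.card_empty, Nat.cast_zero]
    positivity

/-- **Summing the counting recursion over the progression**:
`∑_{n ∈ [N]} F_k(M, Wn + b) ≤ N · S_{k,0}(M) + R^k`. [folklore] -/
theorem sum_lcmCount_le (R : ℕ) {W b : ℕ} (hb : Nat.Coprime b W) (hW : 1 ≤ W) (N : ℕ) :
    ∀ k M : ℕ, ∑ n ∈ Icc 1 N, lcmCount R ((W : ℤ) * n + b) k M ≤
      N * lcmMomentSum R k 0 M + (R : ℝ) ^ k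
  | 0, M => by
    classical
    simp only [lcmCount, lcmMomentSum, pow_zero, one_div]
    rw [Finset.sum_boole, ← div_eq_mul_inv]
    exact card_filter_dvd_progression_le hb hW M N
  | k + 1, M => by
    show ∑ n ∈ Icc 1 N, ∑ e ∈ Icc 1 R, lcmCount R ((W : ℤ) * n + b) k (Nat.lcm M e) ≤
      N * (∑ e ∈ Icc 1 R, lcmMomentSum R k 0 (Nat.lcm M e)) + (R : ℝ) ^ (k + 1)
    rw [Finset.sum_comm]
    calc ∑ e ∈ Icc 1 R, ∑ n ∈ Icc 1 N, lcmCount R ((W : ℤ) * n + b) k (Nat.lcm M e)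
        ≤ ∑ e ∈ Icc 1 R, (N * lcmMomentSum R k 0 (Nat.lcm M e) + (R : ℝ) ^ k) :=
          Finset.sum_le_sum fun e _ => sum_lcmCount_le R hb hW N k _
      _ = N * (∑ e ∈ Icc 1 R, lcmMomentSum R k 0 (Nat.lcm M e)) + (R : ℝ) ^ (k + 1) := by
          rw [Finset.sum_add_distrib, ← Finset.mul_sum, Finset.sum_const, Nat.card_Icc,
            Nat.add_sub_cancel, nsmul_eq_mul, pow_succ']

/-- **Moments of the truncated divisor count along a `W`-progression**: for `b` coprime to
`W ≥ 1`, `∑_{n ∈ [N]} d_R(Wn + b)^k ≤ N (1 + log R)^{f(k,0)} + R^k`.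
[cite: GreenTao2010, App. D (proof of Prop. 6.4: "crude divisor estimates")] -/
theorem sum_truncCount_pow_le (R k : ℕ) {W b : ℕ} (hb : Nat.Coprime b W) (hW : 1 ≤ W) (N : ℕ) :
    ∑ n ∈ Icc 1 N, (truncCount R ((W : ℤ) * n + b) : ℝ) ^ k ≤
      N * (1 + Real.log R) ^ (lcmLogExp k 0) + (R : ℝ) ^ k := by
  have h := sum_lcmCount_le R hb hW N k 1
  simp only [lcmCount_eq, Nat.cast_one, one_dvd, if_true, one_mul] at h
  have h2 := mul_le_mul_of_nonneg_left (lcmMomentSum_zero_one_le R k) (Nat.cast_nonneg N)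
  linarith

/-! ### Moments of `Λ_{χ,R,2}` along a `W`-progression -/

/-- `|∑_{e ∣ y, e ≤ R} μ(e) χ(log e / log R)| ≤ B · d_R(y)` for `|χ| ≤ B`. [folklore] -/
theorem abs_moebiusDivisorSum_le {χ : ℝ → ℝ} {B : ℝ} (hB : ∀ x, |χ x| ≤ B) (R : ℝ) (y : ℤ) :
    |moebiusDivisorSum χ R y| ≤ B * truncCount ⌊R⌋₊ y := by
  unfold moebiusDivisorSum truncCount
  refine (Finset.abs_sum_le_sum_abs _ _).trans ?_
  calc ∑ e ∈ (Icc 1 ⌊R⌋₊).filter (fun e : ℕ => (e : ℤ) ∣ y),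
        |(ArithmeticFunction.moebius e : ℝ) * χ (Real.log e / Real.log R)|
      ≤ ∑ e ∈ (Icc 1 ⌊R⌋₊).filter (fun e : ℕ => (e : ℤ) ∣ y), B := by
        refine Finset.sum_le_sum fun e _ => ?_
        rw [abs_mul]
        have hμ : |(ArithmeticFunction.moebius e : ℝ)| ≤ 1 := by
          exact_mod_cast ArithmeticFunction.abs_moebius_le_one
        calc |(ArithmeticFunction.moebius e : ℝ)| * |χ (Real.log e / Real.log R)|
            ≤ 1 * B := mul_le_mul hμ (hB _) (abs_nonneg _) zero_le_one
          _ = B := one_mul B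
    _ = B * _ := by rw [Finset.sum_const, nsmul_eq_mul, mul_comm]

/-- `Λ_{χ,R,2}(y)^m ≤ (log R)^m B^{2m} d_R(y)^{2m}` for `R ≥ 1`, `|χ| ≤ B`. [folklore] -/
theorem truncDivisorSum_two_pow_le {χ : ℝ → ℝ} {B : ℝ} (hB : ∀ x, |χ x| ≤ B) {R : ℝ} (hR : 1 ≤ R)
    (y : ℤ) (m : ℕ) :
    truncDivisorSum χ R 2 y ^ m ≤ Real.log R ^ m * B ^ (2 * m) * (truncCount ⌊R⌋₊ y : ℝ) ^ (2 * m) := by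
  have hB0 : 0 ≤ B := (abs_nonneg _).trans (hB 0)
  have hlog : 0 ≤ Real.log R := Real.log_nonneg hR
  unfold truncDivisorSum
  rw [mul_pow, ← pow_mul, mul_assoc, ← mul_pow]
  refine mul_le_mul_of_nonneg_left ?_ (pow_nonneg hlog m)
  have h2 : moebiusDivisorSum χ R y ^ (2 * m) = |moebiusDivisorSum χ R y| ^ (2 * m) := by
    rw [pow_mul, pow_mul, sq_abs]
  rw [h2]
  exact pow_le_pow_left₀ (abs_nonneg _) (abs_moebiusDivisorSum_le hB R y) _

/-- **Crude moments of `Λ_{χ,R,2}` along a `W`-progression**: for `|χ| ≤ B`, `R ≥ 1` and `b`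
coprime to `W ≥ 1`,
`∑_{n ∈ [N]} Λ_{χ,R,2}(Wn + b)^m ≤ (log R)^m B^{2m} (N (1 + log ⌊R⌋)^{f(2m,0)} + ⌊R⌋^{2m})`.
[cite: GreenTao2010, App. D (proof of Prop. 6.4: "crude divisor estimates")] -/
theorem sum_truncDivisorSum_two_pow_le {χ : ℝ → ℝ} {B : ℝ} (hB : ∀ x, |χ x| ≤ B) {R : ℝ}
    (hR : 1 ≤ R) {W b : ℕ} (hb : Nat.Coprime b W) (hW : 1 ≤ W) (N m : ℕ) :
    ∑ n ∈ Icc 1 N, truncDivisorSum χ R 2 ((W : ℤ) * n + b) ^ m ≤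
      Real.log R ^ m * B ^ (2 * m) *
        (N * (1 + Real.log ⌊R⌋₊) ^ (lcmLogExp (2 * m) 0) + (⌊R⌋₊ : ℝ) ^ (2 * m)) := by
  have hB0 : 0 ≤ B := (abs_nonneg _).trans (hB 0)
  have hlog : 0 ≤ Real.log R := Real.log_nonneg hR
  calc ∑ n ∈ Icc 1 N, truncDivisorSum χ R 2 ((W : ℤ) * n + b) ^ m
      ≤ ∑ n ∈ Icc 1 N, Real.log R ^ m * B ^ (2 * m) *
          (truncCount ⌊R⌋₊ ((W : ℤ) * n + b) : ℝ) ^ (2 * m) :=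
        Finset.sum_le_sum fun n _ => truncDivisorSum_two_pow_le hB hR _ m
    _ = Real.log R ^ m * B ^ (2 * m) *
          ∑ n ∈ Icc 1 N, (truncCount ⌊R⌋₊ ((W : ℤ) * n + b) : ℝ) ^ (2 * m) := by
        rw [Finset.mul_sum]
    _ ≤ _ := mul_le_mul_of_nonneg_left (sum_truncCount_pow_le ⌊R⌋₊ (2 * m) hb hW N) (by positivity)

end Literature.NumberTheory.Sieve

end
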